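import Summits.ResolutionOfSingularities.ResolutionOfSingularities.Theorems.HomologicalConductorNoZenoBirthDefs
import Summits.ResolutionOfSingularities.ResolutionOfSingularities.Theorems.HomologicalConductorNoZenoTowerNoetherian
import Summits.ResolutionOfSingularities.ResolutionOfSingularities.Theorems.SyzygyFlatteningRankOneTerminationStageNormal
import Literature.AlgebraicGeometry.Resolution.DivisorialPlace
import HarnessLib

/-!
# Crux `NoZeno` (stmt-ResolutionOfSingularities-16483), line `birth` (v4), `stub_dim2RegularCentre`

Route `ResolutionOfSingularities/HomologicalConductor`, crux
`Summit.ResolutionOfSingularities.ResolutionOfSingularities.Theses.HomologicalConductor.NoZeno`.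
Registered stub of the line `birth` (skeleton v4):

  in transcendence degree `2`, past a maximality witness `s` for a coarsening `O ≤ O₁ ≠ K`
  (`s ∈ T_{m₀}`, `s⁻¹ ∈ O₁ ∖ O`), the centre `𝔭` of `O₁` on a later stage `T = T_m` (`m₀ < m`)
  of the canonical normalised `ca`-tower has a regular local ring `T_𝔭`.

Proof.
* `T` is a noetherian domain (`stub_towerNoetherian`) containing `A` (`tn_tower_invariant`), so
  `Frac T = K`; it is integrally closed because `m ≥ 1`:
  `T_(n+1) = loc O (nrm (chart O T_n))` is the localisation at the centre of the normalisation
  of a subalgebra with fraction field `K` (`SyzygyFlattening.isIntegrallyClosed_nrm`,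
  `SyzygyFlattening.isIntegrallyClosed_locAt`; `d2rc_isIntegrallyClosed_tower_succ`).
* `dim T ≤ 2`: `tr.deg_k T ≤ tr.deg_k K = 2` along `T ↪ K` and `dim ≤ tr.deg` for domains over a
  field (tree `ringKrullDim_le_of_trdeg_le`).
* `𝔭 < 𝔮 := centre of O on T`: `O ≤ O₁` gives `𝔭 ≤ 𝔮`; the witness `s` lies in `T`
  (monotonicity of the tower, `d2rc_mem_tower_of_le`), outside `𝔭` (`s⁻¹ ∈ O₁`) but inside `𝔮`
  (`s⁻¹ ∉ O`).
* `𝔭 ≠ ⊥`: an element `y ∉ O₁` is `a / b` with `a, b ∈ A ⊆ T`; then `b ≠ 0` and `b⁻¹ ∉ O₁`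
  (else `y = a · b⁻¹ ∈ O₁`), so `b ∈ 𝔭`.
* Hence `height 𝔭 + 1 ≤ height 𝔮 ≤ dim T ≤ 2` and `height 𝔭 ≠ 0`, i.e. `height 𝔭 = 1`, and a
  noetherian normal domain localised at a height-one prime is a DVR
  (`isDiscreteValuationRing_localization_of_height_eq_one`), in particular a regular local ring
  (Mathlib: a local PID domain is regular).
-/

noncomputable section

-- single-problem summit: the doubled namespace component `ResolutionOfSingularities` is forced
set_option linter.dupNamespace false

namespace Summit.ResolutionOfSingularities.ResolutionOfSingularities.Theorems.NoZeno.Birth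

open Summit.ResolutionOfSingularities.ResolutionOfSingularities.Theses.HomologicalConductor

open Literature.AlgebraicGeometry.Resolution

variable {k K : Type} [Field k] [Field K] [Algebra k K]

/-! ## Helpers: monotonicity and normality of the tower -/

/-- The tower is increasing (membership form): `n ≤ n' → x ∈ T_n → x ∈ T_(n')`, one step
being `B ≤ chart O B ≤ nrm (chart O B) ≤ loc O (nrm (chart O B)) = T_(n+1)` for `B = T_n`.
[folklore] -/
theorem d2rc_mem_tower_of_le (O : ValuationSubring K) (A : Subalgebra k K) {n n' : ℕ}
    (h : n ≤ n') {x : K} (hx : x ∈ tower O A n) : x ∈ tower O A n' := by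
  induction h with
  | refl => exact hx
  | step _ ih =>
    rw [tower_succ]
    exact SyzygyFlattening.self_le_locAt O _ (SyzygyFlattening.self_le_nrm _
      (Algebra.subset_adjoin (Or.inl ih)))

/-- **Every stage of the tower from `T₁` on is normal**: `T_(n+1) = loc O (nrm C)` with
`C := chart O T_n ⊆ O` a subalgebra containing `A`, so `Frac C = K`, `nrm C` is integrally
closed with `nrm C ⊆ O`, and its localisation at the centre of `O` stays integrally closed
(pattern of `SyzygyFlattening.stub_stageNormal`). [cite: AtiyahMacdonald1969, Prop. 5.12] -/
theorem d2rc_isIntegrallyClosed_tower_succ (O : ValuationSubring K) (A : Subalgebra k K)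
    (hk : ∀ c : k, algebraMap k K c ∈ O) (hA : A.FG) (hfr : IsFractionRing ↥A K)
    (hAO : A.toSubring ≤ O.toSubring) (n : ℕ) :
    IsIntegrallyClosed ↥(tower O A (n + 1)) := by
  -- adapted from `SyzygyFlattening.stub_stageNormal` and `tn_tower_invariant`
  haveI := hfr
  obtain ⟨hAT, hTO, -⟩ := tn_tower_invariant O A hk hA hfr hAO n
  have hTc : tower O A n ≤ chart O (tower O A n) := fun _ hb => Algebra.subset_adjoin (Or.inl hb)
  have hAc : A ≤ chart O (tower O A n) := hAT.trans hTc
  have hcO : (chart O (tower O A n)).toSubring ≤ O.toSubring := by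
    refine SyzygyFlattening.adjoin_toSubring_le_valuationSubring O hk ?_
    rintro y (hy | ⟨c, hc, x, -, -, hmin, rfl⟩)
    · exact hTO (Subalgebra.mem_toSubring.mpr hy)
    · exact hmin c hc
  haveI : IsFractionRing ↥(chart O (tower O A n)) K := isFractionRing_subalgebra_of_le A _ hAc
  haveI : IsIntegrallyClosed ↥(SyzygyFlattening.nrm (chart O (tower O A n))) :=
    SyzygyFlattening.isIntegrallyClosed_nrm _
  have hnO : (SyzygyFlattening.nrm (chart O (tower O A n))).toSubring ≤ O.toSubring :=
    SyzygyFlattening.nrm_toSubring_le O hk hcO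
  rw [tower_succ, loc_eq_locAt, nrm_eq_nrm]
  exact SyzygyFlattening.isIntegrallyClosed_locAt O _ hnO

/-- **Every stage of the tower has Krull dimension at most `tr.deg_k K`** (when the latter is a
natural number `d`): `tr.deg_k T_m ≤ tr.deg_k K` along `T_m ↪ K`, and `dim ≤ tr.deg` for
domains over a field. [cite: Matsumura1987, Thm. 5.6] -/
theorem d2rc_ringKrullDim_tower_le (O : ValuationSubring K) (A : Subalgebra k K) (m : ℕ) {d : ℕ}
    (htr : Algebra.trdeg k K ≤ d) : ringKrullDim ↥(tower O A m) ≤ d := by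
  refine ringKrullDim_le_of_trdeg_le (k := k) ?_
  exact (trdeg_le_of_injective (tower O A m).val Subtype.val_injective).trans htr

/-! ## The registered stub -/

/-- **STUB `stub_dim2RegularCentre` (line `birth` of crux `NoZeno`, v4).** In transcendence
degree `2`, past a maximality witness `s ∈ T_{m₀}` (`s⁻¹ ∈ O₁ ∖ O`) for a coarsening
`O ≤ O₁ ≠ K`, the centre `𝔭` of `O₁` on a later stage `T = T_m` (`m₀ < m`) has regular local
ring `T_𝔭`: `T` is a normal noetherian domain (`m ≥ 1`) with `Frac T = K`, `dim T ≤ tr.deg = 2`;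
`𝔭` lies strictly below the centre `𝔮` of `O` (`s ∈ 𝔮 ∖ 𝔭`) and is non-zero (`O₁ ≠ K`), so
`height 𝔭 = 1` and `T_𝔭` is a DVR, hence regular. [cite: Matsumura1987, Thm. 11.2] -/
theorem stub_dim2RegularCentre (k K : Type) [Field k] [Field K] [Algebra k K]
    (O : ValuationSubring K) (A : Subalgebra k K) (hk : ∀ c : k, algebraMap k K c ∈ O) (hA : A.FG)
    (hfr : IsFractionRing ↥A K) (hAO : A.toSubring ≤ O.toSubring) (htr : Algebra.trdeg k K = 2)
    (O₁ : ValuationSubring K) (hOO₁ : O ≤ O₁) (hne : O₁ ≠ ⊤) (m₀ : ℕ) (s : K)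
    (hs : s ∈ tower O A m₀) (hsU : s⁻¹ ∈ O₁) (hsO : s⁻¹ ∉ O) (m : ℕ) (hm : m₀ < m)
    (𝔭 : Ideal ↥(tower O A m)) [𝔭.IsPrime]
    (h𝔭 : ∀ x : ↥(tower O A m), x ∈ 𝔭 ↔ (x : K) ∈ O₁.nonunits) :
    IsRegularLocalRing (Localization.AtPrime 𝔭) := by
  haveI := hfr
  -- `T := tower O A m` is a normal noetherian domain (`m = m₀ + d + 1 ≥ 1`)
  haveI : IsNoetherianRing ↥(tower O A m) := stub_towerNoetherian k K O A hk hA hfr hAO m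
  obtain ⟨d, rfl⟩ := Nat.exists_eq_add_of_lt hm
  haveI : IsIntegrallyClosed ↥(tower O A (m₀ + d + 1)) :=
    d2rc_isIntegrallyClosed_tower_succ O A hk hA hfr hAO (m₀ + d)
  obtain ⟨hAT, hTO, -⟩ := tn_tower_invariant O A hk hA hfr hAO (m₀ + d + 1)
  -- the centre `𝔮` of `O` on `T`, a prime above `𝔭`
  set 𝔮 : Ideal ↥(tower O A (m₀ + d + 1)) := centreIdeal (tower O A (m₀ + d + 1)) O hTO
  have h𝔭𝔮 : 𝔭 ≤ 𝔮 := fun x hx =>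
    (mem_centreIdeal_iff_coe_mem_nonunits _ O hTO x).mpr
      (ValuationSubring.nonunits_le_nonunits.mpr hOO₁ ((h𝔭 x).mp hx))
  -- the witness `s` lies in `𝔮 ∖ 𝔭`
  have hs0 : s ≠ 0 := by
    rintro rfl
    exact hsO (by rw [inv_zero]; exact O.zero_mem)
  have hsT : s ∈ tower O A (m₀ + d + 1) := d2rc_mem_tower_of_le O A hm.le hs
  have hs𝔮 : (⟨s, hsT⟩ : ↥(tower O A (m₀ + d + 1))) ∈ 𝔮 :=
    (mem_centreIdeal_iff_coe_mem_nonunits _ O hTO ⟨s, hsT⟩).mpr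
      (O.mem_nonunits_iff_or.mpr (Or.inr hsO))
  have hs𝔭 : (⟨s, hsT⟩ : ↥(tower O A (m₀ + d + 1))) ∉ 𝔭 := fun h => by
    rcases O₁.mem_nonunits_iff_or.mp ((h𝔭 _).mp h) with h0 | hinv
    · exact hs0 h0
    · exact hinv hsU
  have hlt : 𝔭 < 𝔮 := lt_of_le_of_ne h𝔭𝔮 fun heq => hs𝔭 (heq ▸ hs𝔮)
  -- `𝔭 ≠ ⊥`: a denominator of an element outside `O₁` is a non-zero element of `𝔭`
  have hne_bot : 𝔭 ≠ ⊥ := by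
    obtain ⟨y, -, hy⟩ := SetLike.exists_of_lt hne.lt_top
    obtain ⟨a, b, hb, hab⟩ := IsFractionRing.div_surjective (A := ↥A) y
    have hb0 : (b : K) ≠ 0 := fun h => nonZeroDivisors.ne_zero hb (Subtype.ext h)
    have hbT : (b : K) ∈ tower O A (m₀ + d + 1) := hAT b.2
    have hbinv : (b : K)⁻¹ ∉ O₁ := fun hbinv => hy (by
      rw [← hab, div_eq_mul_inv]
      exact O₁.mul_mem _ _ (hOO₁ (hTO (Subalgebra.mem_toSubring.mpr (hAT a.2)))) hbinv)
    have hb𝔭 : (⟨(b : K), hbT⟩ : ↥(tower O A (m₀ + d + 1))) ∈ 𝔭 :=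
      (h𝔭 _).mpr (O₁.mem_nonunits_iff_or.mpr (Or.inr hbinv))
    intro hbot
    rw [hbot, Ideal.mem_bot] at hb𝔭
    exact hb0 (congrArg Subtype.val hb𝔭)
  -- heights: `height 𝔭 + 1 ≤ height 𝔮 ≤ dim T ≤ 2`, `height 𝔭 ≠ 0`
  have hdim : ringKrullDim ↥(tower O A (m₀ + d + 1)) ≤ (2 : ℕ) :=
    d2rc_ringKrullDim_tower_le O A (m₀ + d + 1) htr.le
  have h𝔮2 : 𝔮.height ≤ 2 := by
    have h : ((𝔮.height : ℕ∞) : WithBot ℕ∞) ≤ ((2 : ℕ∞) : WithBot ℕ∞) :=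
      (Ideal.height_le_ringKrullDim_of_isPrime (I := 𝔮)).trans hdim
    exact WithBot.coe_le_coe.mp h
  have h𝔭2 : 𝔭.height + 1 ≤ 2 := (Ideal.height_add_one_le_of_lt_of_isPrime hlt).trans h𝔮2
  have h𝔭0 : 𝔭.height ≠ 0 := fun h => hne_bot (Ideal.height_eq_zero_iff_eq_bot.mp h)
  have h𝔭1 : 𝔭.height = 1 := by
    have htop : 𝔭.height ≠ ⊤ := by
      intro h
      rw [h, top_add] at h𝔭2
      exact absurd h𝔭2 (by decide)
    obtain ⟨n, hn⟩ := ENat.ne_top_iff_exists.mp htop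
    rw [← hn] at h𝔭2 h𝔭0 ⊢
    have h2 : n + 1 ≤ 2 := by exact_mod_cast h𝔭2
    have h0 : n ≠ 0 := by exact_mod_cast h𝔭0
    have h1 : n = 1 := by omega
    rw [h1]
    rfl
  -- a normal noetherian domain localised at a height-one prime is a DVR, hence regular
  haveI hdvr : IsDiscreteValuationRing (Localization.AtPrime 𝔭) :=
    isDiscreteValuationRing_localization_of_height_eq_one 𝔭 h𝔭1
  haveI : IsPrincipalIdealRing (Localization.AtPrime 𝔭) := hdvr.toIsPrincipalIdealRing
  haveI : IsLocalRing (Localization.AtPrime 𝔭) := hdvr.toIsLocalRing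
  haveI : IsDomain (Localization.AtPrime 𝔭) := inferInstance
  infer_instance

end Summit.ResolutionOfSingularities.ResolutionOfSingularities.Theorems.NoZeno.Birth

end
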